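import Mathlib
import HarnessLib
import Summits.NavierStokesRegularity.NavierStokesRegularity.Theorems.CompletionRelayChainPhaseIChecker

/-!
# Route `CompletionRelayChain` — crux `RelayFrontStep` (stmt-NavierStokesRegularity-24850), K-side of `stub_phaseI`,
  work package K6, data module 27/41: cells `61–63` of the 96-cell grid PASS the self-integrating Phase-I checker

COMPUTATIONAL (`native_decide`, compiled replay ≈ 130 s per cell on the farm; the `native_decide` axiom is disclosed —
the statement is a closed Boolean equation about `…PhaseIChecker.checkCell` (p627039) on explicit grid cells; its
mathematical content is supplied by the soundness theorem `…PhaseISound`).  MODEL-lattice bookkeeping (rung TL-M3-R64);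
nothing here is a statement about the Navier–Stokes equations.
-/

set_option linter.dupNamespace false

namespace Summit.NavierStokesRegularity.NavierStokesRegularity.Cruxes.RelayFrontStep.PhaseI.Checker

/-- Cells `61, …, 63` of `cells` pass `checkCell` (compiled replay). [this file; computational] -/
theorem run_27 : ((cells.drop 61).take 3).all checkCell = true := by
  native_decide

end Summit.NavierStokesRegularity.NavierStokesRegularity.Cruxes.RelayFrontStep.PhaseI.Checker
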